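import Summits.ResolutionOfSingularities.ResolutionOfSingularities.Theorems.WeightedInvariantHypersurfaceCentreAssemblyDefs
import Summits.ResolutionOfSingularities.ResolutionOfSingularities.Theorems.WeightedInvariantHypersurfaceCentreAlgebraizeCentre
import HarnessLib

/-!
# Door assembly H2c″, stub [S4] core — a canonical centre with charts on its maximum locus is a regular weighted centre

Route `ResolutionOfSingularities/WeightedInvariant`, crux `Theses.WeightedInvariant.HypersurfaceCentreConstruction`
(stmt-ResolutionOfSingularities-19897), door line `local-engine`, assembly decomposition of record
`door_assembly_eft3_v1/v2` (res-L1-w43-stub-9 = res-D-brk-1; plan-1 ORDER (o17)). Stub [S4]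
`stub_isRegularWeightedCentre_of_isCanonicalCentre` splits as

  [S4] = (this file)  «closed maximum locus + a weighted chart AT every point of it ⟹ `IsRegularWeightedCentre`»
       ∘ (residual)   «(c9′-open) + (pres) ⟹ such charts ON `Y`» (depends on the final typing of the (open) clause, TP5).

This file proves the first factor: `isRegularWeightedCentre_of_isCanonicalCentre_of_charts` — for a smooth `Y → Spec k`
over a perfect field, a Rees algebra `R` which is a canonical centre (`IsCanonicalCentre ι J X R`: support = the maximum
locus `M`, pieces trivial off `M`), with `M` closed, and which at every point `y ∈ M` admits an affine chart `(U, u, w)`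
presenting its pieces with the `uᵢ` vanishing at `y` with independent differentials THERE, is a regular weighted centre
(Włodarczyk 2.1.10): on `M` by `isRegularWeightedCentre_of_forall_exists_chart_at_of_smooth` (A10, independence spreads),
off `M` by the unit chart on an affine neighbourhood missing the closed set `M`, where every piece is the unit ideal.
Def-free helper (`--supports stmt-ResolutionOfSingularities-19897`); no claim about Hironaka's problem.
-/

noncomputable section

set_option linter.dupNamespace false -- mandated namespace of this single-conjunct summit

open CategoryTheory AlgebraicGeometry TopologicalSpace IsLocalRing
open Literature.AlgebraicGeometry.Resolution
open Summit.ResolutionOfSingularities.ResolutionOfSingularities.Theorems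

namespace Summit.ResolutionOfSingularities.ResolutionOfSingularities.Cruxes.HypersurfaceCentreConstruction.LocalEngine

variable (ι : (R : Type) → [CommRing R] → R → Ordinal.{0}) (J : (R : Type) → [CommRing R] → R → ℕ → Ideal R)

/-- Over an affine open missing the maximum locus, every piece of a canonical centre is the unit ideal. [folklore] -/
theorem IsCanonicalCentre.ideal_piece_eq_top_of_disjoint {Y : Scheme.{0}} {X : Y.IdealSheafData} {R : ReesAlgebraData Y}
    (hR : IsCanonicalCentre ι J X R) (U : Y.affineOpens) (hU : ∀ y ∈ (U : Y.Opens), y ∉ maxLocus ι X) (n : ℕ) :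
    (R.piece n).ideal U = ⊤ := by
  refine ideal_eq_top_of_forall_not_mem_support (R.piece n) U fun y hy hmem => ?_
  have htop := hR.stalkIdeal_eq_top y (hU y hy) n
  have hle := (mem_support_iff_stalkIdeal_le (R.piece n) y).mp hmem
  rw [htop] at hle
  exact (maximalIdeal.isMaximal (Y.presheaf.stalk y)).ne_top (top_le_iff.mp hle)

/-- **[S4] core: a canonical centre with closed maximum locus and weighted charts at the points of the maximum locus is a
regular weighted centre** (Włodarczyk 2.1.10 for the glued centre of the door assembly). Hypotheses: `Y → Spec k` smooth,
`k` perfect; `R` a canonical centre of the pair; `maxLocus ι X` closed ([S1]); at every `y ∈ maxLocus ι X` an affine chart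
`(U, u, w)` with positive weights, `Rₙ(U) = (u^α : Σ wᵢ αᵢ ≥ n)`, the `uᵢ` vanishing at `y` with linearly independent
differentials at `y`. [cite: Wlodarczyk2022, 2.1.10] -/
theorem isRegularWeightedCentre_of_isCanonicalCentre_of_charts {k : Type} [Field k] [PerfectField k]
    {Y : Scheme.{0}} (f : Y ⟶ Spec (.of k)) [Smooth f] {X : Y.IdealSheafData} {R : ReesAlgebraData Y}
    (hR : IsCanonicalCentre ι J X R) (hM : IsClosed (maxLocus ι X))
    (hchart : ∀ y ∈ maxLocus ι X, ∃ (U : Y.affineOpens) (hy : y ∈ (U : Y.Opens)) (m : ℕ) (u : Fin m → Γ(Y, U))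
      (w : Fin m → ℕ), (∀ i, 0 < w i) ∧ (∀ n, (R.piece n).ideal U = weightedMonomialIdeal u w n) ∧
      ∃ hu : ∀ i, (Y.presheaf.germ (U : Y.Opens) y hy).hom (u i) ∈ maximalIdeal (Y.presheaf.stalk y),
        LinearIndependent (ResidueField (Y.presheaf.stalk y))
          fun i => (maximalIdeal (Y.presheaf.stalk y)).toCotangent ⟨_, hu i⟩) :
    R.IsRegularWeightedCentre := by
  refine isRegularWeightedCentre_of_forall_exists_chart_at_of_smooth f R fun y => ?_
  by_cases hy : y ∈ maxLocus ι X
  · -- on the maximum locus: the given chart (independence at `y` is all A10 needs)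
    obtain ⟨U, hyU, m, u, w, hw, hRU, hu, hli⟩ := hchart y hy
    exact ⟨U, hyU, m, u, w, hw, hRU, fun _ => hli⟩
  · -- off the maximum locus: an affine neighbourhood missing the closed set, unit chart
    obtain ⟨U, hU, hyU, hUsub⟩ :=
      exists_isAffineOpen_mem_and_subset (X := Y) (x := y) (U := ⟨(maxLocus ι X)ᶜ, hM.isOpen_compl⟩) hy
    refine ⟨⟨U, hU⟩, hyU, 1, fun _ => 1, fun _ => 1, fun _ => Nat.one_pos, fun n => ?_, fun hu => ?_⟩
    · rw [ReesAlgebraData.weightedMonomialIdeal_one]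
      exact hR.ideal_piece_eq_top_of_disjoint ι J ⟨U, hU⟩ (fun y' hy' hmem => hUsub hy' hmem) n
    · exfalso
      have h0 := hu 0
      rw [map_one] at h0
      exact (maximalIdeal.isMaximal _).ne_top (Ideal.eq_top_of_isUnit_mem _ h0 isUnit_one)

end Summit.ResolutionOfSingularities.ResolutionOfSingularities.Cruxes.HypersurfaceCentreConstruction.LocalEngine

end
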